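import Literature.NumberTheory.DiophantineApproximation.PrimeFractionalPartClassesCutoff
import Literature.NumberTheory.DiophantineApproximation.DilogLandenLinearIndependenceRates
import HarnessLib

/-!
# The class prime product `Δₙ = ∏_{p > √(Cn), {n/p} ∈ Ω} p` of the permutation group method and its rate

Topic `Literature/NumberTheory/DiophantineApproximation`. DEFINITIONS (`classPrimes`, `classPrimeProduct`)
with proved API; no named facts. Sources: G. Rhin, C. Viola, *The permutation group method for the
dilogarithm*, Ann. Sc. Norm. Super. Pisa (5) 4 (2005) 389–437, §4 (pp. 418–420: the primes `p > √(Hn)` with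
`{n/p} ∈ Ω` divide the coefficients); C. Viola, W. Zudilin, J. reine angew. Math. 736 (2018), §6.1:
`Δₙ = ∏_{p > √(Hn), {n/p} ∈ Ω} p` for a finite union `Ω` of intervals `[u,v) ⊂ (0,1)` ((6.1) and the list of
36 intervals for `z = 9` in §6.2), and the rate `lim (1/n) log Δₙ = ∫_Ω dψ` entering
`c₃ = H + H' − ∫_Ω dψ(x)` (there `(1/n) log (d_{Hn} d_{H'n}/Δₙ) → c₃`).

Here `Ω` is a finite set of pairs `(u, v)` standing for the intervals `[u, v)`, the prime range is cut at an
explicit bound `N n ≥ n/u` (harmless: `{n/p} = n/p < u` for `p > n/u`), and the threshold is `p² > C·n`. We prove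
`(1/n) log Δₙ → Σ_{(u,v) ∈ Ω} Σ_k (1/(k+u) − 1/(k+v))` (`= Σ (ψ(v) − ψ(u)) = ∫_Ω dψ`) from the one-interval rate
`RhinViola.tendsto_sum_log_prime_fract_div_cutoff` (`PrimeFractionalPartClassesCutoff.lean`), and the rate
`a + b − ∫_Ω dψ` of the normaliser `d_{an} d_{bn}/Δₙ` (with `ViolaZudilin.tendsto_log_lcmUpto_mul_lcmUpto_div`).

## References

* C. Viola, W. Zudilin, J. reine angew. Math. 736 (2018) 193–223, §6.1 (Δₙ, c₃), §6.2. [ViolaZudilin2018]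
* G. Rhin, C. Viola, Ann. Sc. Norm. Super. Pisa Cl. Sci. (5) 4 (2005) 389–437, §4. [RhinViola2005]
-/

noncomputable section

namespace Literature.NumberTheory.DiophantineApproximation

namespace RhinViola

open _root_.Filter _root_.Topology Finset

/-- The primes of one class: `p ≤ N n` prime with `p² > C n` and `u ≤ {n/p} < v`, for the interval
`I = (u, v)`. [cite: ViolaZudilin2018, §6.1 (6.1)] -/
def classPrimes (C : ℝ) (N : ℕ → ℕ) (I : ℝ × ℝ) (n : ℕ) : Finset ℕ :=
  (range (N n + 1)).filter fun p : ℕ => p.Prime ∧ C * n < (p : ℝ) ^ 2 ∧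
    I.1 ≤ Int.fract ((n : ℝ) / p) ∧ Int.fract ((n : ℝ) / p) < I.2

/-- **`Δₙ = ∏_{p > √(Cn), {n/p} ∈ Ω} p`** for a finite set `Ω` of intervals `[u,v)` (pairs `(u,v)`), the prime
range cut at `N n`. [cite: ViolaZudilin2018, §6.1] -/
def classPrimeProduct (C : ℝ) (N : ℕ → ℕ) (Ω : Finset (ℝ × ℝ)) (n : ℕ) : ℕ :=
  ∏ p ∈ Ω.biUnion (fun I => classPrimes C N I n), p

/-! ### Elementary API -/

/-- Members of a class are primes. [folklore] -/
theorem prime_of_mem_classPrimes {C : ℝ} {N : ℕ → ℕ} {I : ℝ × ℝ} {n p : ℕ} (hp : p ∈ classPrimes C N I n) :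
    p.Prime := by
  simp only [classPrimes, mem_filter] at hp
  exact hp.2.1

/-- Disjoint intervals give disjoint classes. [folklore] -/
theorem pairwiseDisjoint_classPrimes (C : ℝ) (N : ℕ → ℕ) (Ω : Finset (ℝ × ℝ)) (n : ℕ)
    (hΩ : ∀ I ∈ Ω, ∀ I' ∈ Ω, I ≠ I' → Disjoint (Set.Ico I.1 I.2) (Set.Ico I'.1 I'.2)) :
    Set.PairwiseDisjoint (↑Ω : Set (ℝ × ℝ)) (fun I => classPrimes C N I n) := by
  intro I hI I' hI' hne
  rw [Function.onFun, Finset.disjoint_left]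
  intro p hp hp'
  simp only [classPrimes, mem_filter] at hp hp'
  have h1 : Int.fract ((n : ℝ) / p) ∈ Set.Ico I.1 I.2 := ⟨hp.2.2.2.1, hp.2.2.2.2⟩
  have h2 : Int.fract ((n : ℝ) / p) ∈ Set.Ico I'.1 I'.2 := ⟨hp'.2.2.2.1, hp'.2.2.2.2⟩
  exact Set.disjoint_left.1 (hΩ I hI I' hI' hne) h1 h2

/-- `Δₙ` is positive. [folklore] -/
theorem classPrimeProduct_pos (C : ℝ) (N : ℕ → ℕ) (Ω : Finset (ℝ × ℝ)) (n : ℕ) :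
    0 < classPrimeProduct C N Ω n := by
  refine Finset.prod_pos fun p hp => ?_
  obtain ⟨I, -, hI⟩ := mem_biUnion.1 hp
  exact (prime_of_mem_classPrimes hI).pos

/-- **`log Δₙ` is the sum over the classes**: for pairwise disjoint intervals,
`log Δₙ = Σ_{I ∈ Ω} Σ_{p ∈ class I} log p`. [cite: ViolaZudilin2018, §6.1] -/
theorem log_classPrimeProduct (C : ℝ) (N : ℕ → ℕ) (Ω : Finset (ℝ × ℝ)) (n : ℕ)
    (hΩ : ∀ I ∈ Ω, ∀ I' ∈ Ω, I ≠ I' → Disjoint (Set.Ico I.1 I.2) (Set.Ico I'.1 I'.2)) :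
    Real.log (classPrimeProduct C N Ω n) = ∑ I ∈ Ω, ∑ p ∈ classPrimes C N I n, Real.log p := by
  rw [classPrimeProduct, prod_biUnion (pairwiseDisjoint_classPrimes C N Ω n hΩ), Nat.cast_prod,
    Real.log_prod fun I _ => ?_]
  · refine sum_congr rfl fun I _ => ?_
    rw [Nat.cast_prod, Real.log_prod fun p hp => ?_]
    exact_mod_cast (prime_of_mem_classPrimes hp).ne_zero
  · rw [Nat.cast_ne_zero]
    exact (Finset.prod_pos fun p hp => (prime_of_mem_classPrimes hp).pos).ne'

/-! ### The rate `lim (1/n) log Δₙ = ∫_Ω dψ` -/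

/-- **Rate of `Δₙ`** (Viola–Zudilin §6.1, after Rhin–Viola): for a finite set `Ω` of pairwise disjoint
intervals `[u,v)` with `0 < u < v ≤ 1`, a cut `N n ≥ n/u` for every `(u,v) ∈ Ω`, and a threshold `C ≥ 0`,
`(1/n) log Δₙ → Σ_{(u,v)∈Ω} Σ_{k≥0} (1/(k+u) − 1/(k+v)) = Σ_{(u,v)∈Ω} (ψ(v) − ψ(u)) = ∫_Ω dψ`.
[cite: ViolaZudilin2018, §6.1 (c₃)] -/
theorem tendsto_log_classPrimeProduct_div {C : ℝ} (hC : 0 ≤ C) (N : ℕ → ℕ) (Ω : Finset (ℝ × ℝ))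
    (hI : ∀ I ∈ Ω, 0 < I.1 ∧ I.1 < I.2 ∧ I.2 ≤ 1) (hN : ∀ I ∈ Ω, ∀ n : ℕ, (n : ℝ) / I.1 ≤ N n)
    (hΩ : ∀ I ∈ Ω, ∀ I' ∈ Ω, I ≠ I' → Disjoint (Set.Ico I.1 I.2) (Set.Ico I'.1 I'.2)) :
    Tendsto (fun n : ℕ => Real.log (classPrimeProduct C N Ω n) / n) atTop
      (𝓝 (∑ I ∈ Ω, ∑' k : ℕ, (1 / ((k : ℝ) + I.1) - 1 / ((k : ℝ) + I.2)))) := by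
  have h : ∀ I ∈ Ω, Tendsto (fun n : ℕ => (∑ p ∈ classPrimes C N I n, Real.log p) / n) atTop
      (𝓝 (∑' k : ℕ, (1 / ((k : ℝ) + I.1) - 1 / ((k : ℝ) + I.2)))) := by
    intro I hIΩ
    obtain ⟨hu, huv, hv⟩ := hI I hIΩ
    exact tendsto_sum_log_prime_fract_div_cutoff hu huv hv N (hN I hIΩ) hC
  refine (tendsto_finsetSum Ω h).congr fun n => ?_
  rw [log_classPrimeProduct C N Ω n hΩ, sum_div]

/-! ### The normaliser `d_{an} d_{bn}/Δₙ` and its rate `a + b − ∫_Ω dψ` -/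

/-- **Rate of the arithmetic normaliser `Aₙ = d_{an} d_{bn}/Δₙ`** (the `Δₙ^{-1} d_{Hn} d_{H'n}` of Viola–Zudilin,
Prop. 3.1 and §6.1, with `α = β = 0`, `r = 1`): `(1/n) log Aₙ → a + b − ∫_Ω dψ`, i.e. the constant
`c₃ = H + H' − ∫_Ω dψ(x)` for `a = H`, `b = H'` (prime number theorem for `d_{an} d_{bn}`, the rate of `Δₙ`
above). [cite: ViolaZudilin2018, §6.1 (c₃)] -/
theorem tendsto_log_normaliser_div {a b : ℕ} (ha : 0 < a) (hb : 0 < b) {C : ℝ} (hC : 0 ≤ C) (N : ℕ → ℕ)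
    (Ω : Finset (ℝ × ℝ)) (hI : ∀ I ∈ Ω, 0 < I.1 ∧ I.1 < I.2 ∧ I.2 ≤ 1)
    (hN : ∀ I ∈ Ω, ∀ n : ℕ, (n : ℝ) / I.1 ≤ N n)
    (hΩ : ∀ I ∈ Ω, ∀ I' ∈ Ω, I ≠ I' → Disjoint (Set.Ico I.1 I.2) (Set.Ico I'.1 I'.2)) :
    Tendsto (fun n : ℕ => Real.log (((Nat.lcmUpto (a * n) : ℝ) * Nat.lcmUpto (b * n)) /
        classPrimeProduct C N Ω n) / n) atTop
      (𝓝 ((a : ℝ) + b - ∑ I ∈ Ω, ∑' k : ℕ, (1 / ((k : ℝ) + I.1) - 1 / ((k : ℝ) + I.2)))) := by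
  have h1 := ViolaZudilin.tendsto_log_lcmUpto_mul_lcmUpto_div ha hb
  have h2 := tendsto_log_classPrimeProduct_div hC N Ω hI hN hΩ
  refine (h1.sub h2).congr fun n => ?_
  have hd : ((Nat.lcmUpto (a * n) : ℝ) * Nat.lcmUpto (b * n)) ≠ 0 := by
    have := Nat.lcmUpto_pos (a * n)
    have := Nat.lcmUpto_pos (b * n)
    positivity
  have hΔ : (classPrimeProduct C N Ω n : ℝ) ≠ 0 := by
    exact_mod_cast (classPrimeProduct_pos C N Ω n).ne'
  rw [Real.log_div hd hΔ, sub_div]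

end RhinViola

end Literature.NumberTheory.DiophantineApproximation

end
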